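import Literature.Analysis.FluidPDE.TaoAveragedScaleFormsAt
import Literature.Analysis.FluidPDE.TaoAveragedRotations
import Literature.Analysis.FluidPDE.TaoAveragedProfileTransport
import Literature.Analysis.FluidPDE.TaoAveragedSymbolCalculus
import Literature.Analysis.FluidPDE.TaoAveragedRotDil
import HarnessLib

/-!
# Tao 2016, §3.4 (3.9) about a general base triple: covariance under a COMMON rotation of the
# base triple (the dilation-free single-scale representation only depends on the triangle's shape)

T. Tao, *Finite time blowup for an averaged three-dimensional Navier–Stokes equation*,
J. Amer. Math. Soc. **29** (2016), 601–674 = arXiv:1402.0290v3, §3.2 p. 15 ("due to the presence of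
rotations … in the definition of a complex average, we have the freedom to rotate … each of the
`ξⱼ⁰` as we please"), §3.4 (3.9), §3.7 p. 19 (the invariance
`Λ_{R₁ξ₁,R₂ξ₂,R₃ξ₃}(R₁X₁,R₂X₂,R₃X₃) = Λ_{ξ̃}(…)` under a common rotation), Remark 3.5 p. 20.
HONEST FRAMING (cell harvest/h2-tao-ladder, TAO-LADDER rung M_1 — MODEL statements about Tao's
averaged equation): groundwork for the rung-1 crux `SingleScaleNoDilAt` ((3.9) with `λ ≡ 1` at
EVERY closed base triangle with sides in a window): this file proves that the sentence "for all
profiles normalised about `ξ`, `C₀` is a dilation-free complex average of `B_{η,ρ,0;ξ}`" is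
invariant under replacing the base triple `ξ` by `S ∘ ξ` for any linear isometry `S` of `ℝ³`, so
that it suffices to treat base triangles in a standard position (e.g. in the horizontal plane, as
Tao's (3.7)). Nothing here concerns the true Navier–Stokes equations.

* `weightedForm_rot` — covariance of weighted Euler forms under a common rotation of the three
  fields: `W`-form`(Rot_S a, Rot_S b, Rot_S c) = W(S·, S·)`-form`(a, b, c)` (change of variables on
  `{ζ₁+ζ₂+ζ₃ = 0}` and `Λ_rotMat`);
* `scaleWeightAt_rot_zero`, `betaRhoZeroFormAt_rot` — the weight `φ(|ζ₁ - ξ 0|/ε₀²) η_ξ` is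
  invariant, hence `B_{η,ρ,0;S∘ξ}(Rot_S a, Rot_S b, Rot_S c) = B_{η,ρ,0;ξ}(a, b, c)`;
* `ComplexAveragingDatum.conjRot S` — **the datum conjugated by a common rotation**: symbols
  `m_{j,ω} ∘ S⁻¹`, rotations `S R_{j,ω} S⁻¹`, the same dilation factors (so `λ ≡ 1` is preserved);
  `conjRot_slot`: its slots are `Rot_S ∘ (m_{j,ω}(D) Rot_{R_{j,ω}} Dil_{λ_{j,ω}}) ∘ Rot_{S⁻¹}`;
* `singleScaleForm_schwartzRot` — `C₀[Rot_{S⁻¹}ψ](u,v,w) = C₀[ψ](Rot_S u, Rot_S v, Rot_S w)`;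
* **`singleScaleAt_isComplexAverageNoDil_rotate`** — if every profile triple normalised about `ξ`
  gives a dilation-free complex average of `B_{η,ρ,0;ξ}`, then every profile triple normalised
  about `S ∘ ξ` gives a dilation-free complex average of `B_{η,ρ,0;S∘ξ}`.

## References

* T. Tao, J. Amer. Math. Soc. 29 (2016), 601–674, arXiv:1402.0290v3, §3.2 p. 15, §3.4 (3.9),
  §3.7 p. 19, Remark 3.5 p. 20. Key `Tao2016AveragedNS`.
-/

noncomputable section

open MeasureTheory Set Filter FourierTransform
open scoped ENNReal NNReal SchwartzMap ComplexConjugate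

namespace Literature.Analysis.FluidPDE.Tao2016

/-- Local notation for physical / frequency space `ℝ³`. -/
local notation "ℝ³" => EuclideanSpace ℝ (Fin 3)
/-- Local notation for the complexified range `ℂ³`. -/
local notation "ℂ³" => EuclideanSpace ℂ (Fin 3)

/-! ### Covariance of weighted Euler forms under a common rotation -/

/-- **A common rotation of the three fields rotates the weight**:
`∫ W(ζ) Λ_ζ(\widehat{Rot_S a}, \widehat{Rot_S b}, \widehat{Rot_S c}) = ∫ W(Sζ₁, Sζ₂) Λ_ζ(â, b̂, ĉ)`
(`\widehat{Rot_S a}(ζ) = S â(S⁻¹ζ)`, the change of variables `ζⱼ ↦ Sζⱼ` on `{ζ₁+ζ₂+ζ₃=0}`, and the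
invariance `Λ_{Sζ}(SX, SY, SZ) = Λ_ζ(X, Y, Z)`). [cite: Tao2016AveragedNS, §3.7 p. 19] -/
theorem weightedForm_rot (S : ℝ³ ≃ₗᵢ[ℝ] ℝ³) (W : ℝ³ × ℝ³ → ℝ) (a b c : L2C) :
    weightedForm W (rot S a) (rot S b) (rot S c) =
      weightedForm (fun p => W (S p.1, S p.2)) a b c := by
  rw [weightedForm_eq_integral_of_ae_eq W (fourierFn_rot S a) (fourierFn_rot S b) (fourierFn_rot S c)]
  have hT : MeasurePreserving (Prod.map S S) ((volume : Measure ℝ³).prod volume)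
      ((volume : Measure ℝ³).prod volume) := S.measurePreserving.prod S.measurePreserving
  have hTe : MeasurableEmbedding (Prod.map S S) :=
    (S.toHomeomorph.prodCongr S.toHomeomorph).measurableEmbedding
  unfold weightedForm eulerIntegrand
  rw [Measure.volume_eq_prod, ← hT.integral_comp hTe]
  refine integral_congr_ae (Eventually.of_forall fun q => ?_)
  simp only [Prod.map_fst, Prod.map_snd]
  rw [show -(S q.1) - S q.2 = S (-q.1 - q.2) by simp [map_neg, map_sub], S.symm_apply_apply,
    S.symm_apply_apply, S.symm_apply_apply, Λ_rotMat]
  rfl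

/-- **The weight of `B_{η,ρ,0;ξ}` is covariant**: `w_{S∘ξ}(Sζ₁, Sζ₂) = w_ξ(ζ₁, ζ₂)` (all moduli and
`|Sζ₁ - S(ξ 0)| = |ζ₁ - ξ 0|` are preserved). [cite: Tao2016AveragedNS, §3.4 (3.9)] -/
theorem scaleWeightAt_rot_zero (S : ℝ³ ≃ₗᵢ[ℝ] ℝ³) (ξ : Fin 3 → ℝ³) (ε₀ : ℝ) (p : ℝ³ × ℝ³) :
    scaleWeightAt (fun j => S (ξ j)) ε₀ 0 (S p.1, S p.2) = scaleWeightAt ξ ε₀ 0 p := by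
  unfold scaleWeightAt etaAt
  simp only [neg_zero, zpow_zero, one_smul]
  rw [show -(S p.1) - S p.2 = S (-p.1 - p.2) by simp [map_neg, map_sub], ← map_sub,
    LinearIsometryEquiv.norm_map, LinearIsometryEquiv.norm_map, LinearIsometryEquiv.norm_map,
    LinearIsometryEquiv.norm_map, LinearIsometryEquiv.norm_map, LinearIsometryEquiv.norm_map,
    LinearIsometryEquiv.norm_map]

/-- **`B_{η,ρ,0;S∘ξ}(Rot_S a, Rot_S b, Rot_S c) = B_{η,ρ,0;ξ}(a, b, c)`** for every linear isometry
`S` and all `a, b, c ∈ L²`. [cite: Tao2016AveragedNS, §3.4 (3.9) and §3.7 p. 19] -/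
theorem betaRhoZeroFormAt_rot (S : ℝ³ ≃ₗᵢ[ℝ] ℝ³) (ξ : Fin 3 → ℝ³) (ε₀ : ℝ) (a b c : L2C) :
    betaRhoZeroFormAt (fun j => S (ξ j)) ε₀ (rot S a) (rot S b) (rot S c) =
      betaRhoZeroFormAt ξ ε₀ a b c := by
  rw [betaRhoZeroFormAt_eq_weightedForm, betaRhoZeroFormAt_eq_weightedForm, weightedForm_rot]
  congr 1
  funext p
  exact scaleWeightAt_rot_zero S ξ ε₀ p

/-! ### The datum conjugated by a common rotation -/

namespace ComplexAveragingDatum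

variable (𝒟 : ComplexAveragingDatum)

/-- `det S · det S⁻¹ = 1` for a linear isometry `S`. [folklore] -/
private theorem det_mul_det_symm (S : ℝ³ ≃ₗᵢ[ℝ] ℝ³) :
    LinearMap.det (S.toLinearEquiv : ℝ³ →ₗ[ℝ] ℝ³) *
      LinearMap.det (S.symm.toLinearEquiv : ℝ³ →ₗ[ℝ] ℝ³) = 1 := by
  rw [← det_toLinearEquiv_trans, LinearIsometryEquiv.symm_trans_self]
  exact LinearMap.det_id

/-- **The complex averaging datum conjugated by a common rotation `S`** (a linear isometry of
`ℝ³`): same `(Ω, μ)`, symbols `m_{j,ω} ∘ S⁻¹` (rotations normalise `𝓜₀ ⊗ ℂ`, the seminorms (1.10)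
being rotation invariant), rotations `S R_{j,ω} S⁻¹` (still in `SO(3)`), the SAME dilation factors.
[cite: Tao2016AveragedNS, §3.2 pp. 15–16] -/
def conjRot (S : ℝ³ ≃ₗᵢ[ℝ] ℝ³) : ComplexAveragingDatum where
  Ω := 𝒟.Ω
  μ := 𝒟.μ
  m i θ := fun ζ => 𝒟.m i θ (S.symm ζ)
  R i θ := (S.symm.trans (𝒟.R i θ)).trans S
  lam := 𝒟.lam
  isComplexSymbol i θ := by
    simpa only [one_smul] using (𝒟.isComplexSymbol i θ).comp_smul_isometry one_ne_zero S.symm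
  det_R i θ := by
    rw [det_toLinearEquiv_trans, det_toLinearEquiv_trans, 𝒟.det_R i θ, one_mul, det_mul_det_symm]
  lam_pos := 𝒟.lam_pos
  lam_bdd := 𝒟.lam_bdd
  moment k₁ k₂ k₃ := by
    have hle : ∀ (i : Fin 3) (θ : 𝒟.Ω) (k : ℕ),
        symbolSeminorm k (fun ζ => 𝒟.m i θ (S.symm ζ)) ≤ symbolSeminorm k (𝒟.m i θ) := by
      intro i θ k
      simpa only [one_smul] using symbolSeminorm_comp_smul_isometry_le (𝒟.m i θ) one_ne_zero S.symm k
    refine lt_of_le_of_lt (lintegral_mono fun θ => ?_) (𝒟.moment k₁ k₂ k₃)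
    exact mul_le_mul' (mul_le_mul' (hle 0 θ k₁) (hle 1 θ k₂)) (hle 2 θ k₃)
  measurable_m i ζ hζ := 𝒟.measurable_m i (S.symm ζ) (by
    intro h
    exact hζ (by simpa using congrArg S h))
  measurable_R i x := S.continuous.measurable.comp (𝒟.measurable_R i (S.symm x))
  measurable_lam := 𝒟.measurable_lam

/-- The conjugated datum has the same dilation factors (in particular `λ ≡ 1` is preserved).
[cite: Tao2016AveragedNS, §3.4 (3.9)] -/
theorem conjRot_lam (S : ℝ³ ≃ₗᵢ[ℝ] ℝ³) (i : Fin 3) (θ : 𝒟.Ω) :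
    (𝒟.conjRot S).lam i θ = 𝒟.lam i θ := rfl

/-- **The slots of the conjugated datum**: `(m∘S⁻¹)(D) Rot_{S R S⁻¹} Dil_λ = Rot_S ∘ (m(D) Rot_R Dil_λ) ∘ Rot_{S⁻¹}`
("the group of rotation operators normalises the algebra `𝓜₀`", p. 6). [cite: Tao2016AveragedNS, §1.1 p. 6 and §3.2 p. 15] -/
theorem conjRot_slot (S : ℝ³ ≃ₗᵢ[ℝ] ℝ³) (i : Fin 3) (θ : 𝒟.Ω) (U : L2C) :
    (𝒟.conjRot S).slot i θ U = rot S (𝒟.slot i θ (rot S.symm U)) := by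
  have hm : MemLp (𝒟.m i θ) ∞ (volume : Measure ℝ³) := (𝒟.isComplexSymbol i θ).memLp_top
  have hmR : MemLp (fun ζ => 𝒟.m i θ (S.symm ζ)) ∞ (volume : Measure ℝ³) :=
    ((𝒟.conjRot S).isComplexSymbol i θ).memLp_top
  change fourierMultiplier (hmR.toLp _) (rot ((S.symm.trans (𝒟.R i θ)).trans S) (dil (𝒟.lam i θ) U)) =
    rot S (fourierMultiplier (hm.toLp _) (rot (𝒟.R i θ) (dil (𝒟.lam i θ) (rot S.symm U))))
  rw [dil_rot, rot_rot, rot_fourierMultiplier S hm hmR, rot_rot]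

/-- The average over the conjugated datum. [cite: Tao2016AveragedNS, Def. 3.4 (3.4)] -/
theorem conjRot_average (S : ℝ³ ≃ₗᵢ[ℝ] ℝ³) (C' : L2C → L2C → L2C → ℂ) (U V W : L2C) :
    (𝒟.conjRot S).average C' U V W =
      ∫ θ, C' (rot S (𝒟.slot 0 θ (rot S.symm U))) (rot S (𝒟.slot 1 θ (rot S.symm V)))
        (rot S (𝒟.slot 2 θ (rot S.symm W))) ∂𝒟.μ := by
  change ∫ θ, C' ((𝒟.conjRot S).slot 0 θ U) ((𝒟.conjRot S).slot 1 θ V)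
      ((𝒟.conjRot S).slot 2 θ W) ∂𝒟.μ = _
  simp only [conjRot_slot]

end ComplexAveragingDatum

/-! ### The single-scale form under rotated profiles -/

/-- `Rot_S (Rot_{S⁻¹} u) = u`. [folklore] -/
private theorem rot_rot_symm (S : ℝ³ ≃ₗᵢ[ℝ] ℝ³) (u : L2C) : rot S (rot S.symm u) = u := by
  rw [rot_rot, LinearIsometryEquiv.symm_trans_self, rot_refl]

/-- `Rot_{S⁻¹} (Rot_S u) = u`. [folklore] -/
private theorem rot_symm_rot (S : ℝ³ ≃ₗᵢ[ℝ] ℝ³) (u : L2C) : rot S.symm (rot S u) = u := by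
  rw [rot_rot, LinearIsometryEquiv.self_trans_symm, rot_refl]

/-- **`C₀` with the profiles rotated by `S⁻¹` is `C₀` at the fields rotated by `S`**:
`⟨u, \overline{Rot_{S⁻¹}ψ}⟩ = ⟨Rot_S u, ψ̄⟩` in each factor (`Rot` is unitary and real).
[cite: Tao2016AveragedNS, §3.2 p. 15 and §3.4 (3.8)] -/
theorem singleScaleForm_schwartzRot (S : ℝ³ ≃ₗᵢ[ℝ] ℝ³) (ψ : Fin 3 → 𝓢(ℝ³, ℂ³)) (u v w : L2C) :
    singleScaleForm (schwartzRot S.symm (ψ 0)) (schwartzRot S.symm (ψ 1)) (schwartzRot S.symm (ψ 2))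
        u v w =
      singleScaleForm (ψ 0) (ψ 1) (ψ 2) (rot S u) (rot S v) (rot S w) := by
  have h : ∀ (j : Fin 3) (x : L2C), pairing x (conjL2 ((schwartzRot S.symm (ψ j)).toLp 2)) =
      pairing (rot S x) (conjL2 ((ψ j).toLp 2)) := by
    intro j x
    rw [toLp_schwartzRot, conjL2_rot, ← pairing_rot_rot S x, rot_rot_symm]
  simp only [singleScaleForm, h]

/-! ### Covariance of the dilation-free single-scale representation -/

/-- **(3.9) without dilations only depends on the base triangle up to a common rotation**: if for
every profile triple normalised about `ξ` (`ψ̂ⱼ ⊆ B(ξ j, ε₀³)`) the single-scale form `C₀` is a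
DILATION-FREE complex average of `B_{η,ρ,0;ξ}`, then the same holds about `S ∘ ξ` for every linear
isometry `S` of `ℝ³`: given `ψ` normalised about `S ∘ ξ`, apply the hypothesis to `Rot_{S⁻¹}ψ`
(normalised about `ξ`), and conjugate the resulting datum by `S` (`conjRot`; `Rot_S` commutes past
`B_{η,ρ,0}`: `betaRhoZeroFormAt_rot`). [cite: Tao2016AveragedNS, §3.2 p. 15, §3.4 (3.9), Remark 3.5 p. 20] -/
theorem singleScaleAt_isComplexAverageNoDil_rotate (S : ℝ³ ≃ₗᵢ[ℝ] ℝ³) {ξ : Fin 3 → ℝ³} {ε₀ : ℝ}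
    (h : ∀ ψ : Fin 3 → 𝓢(ℝ³, ℂ³), NormalisedProfilesAt ξ ε₀ ψ →
      IsComplexAverageNoDilOf (singleScaleForm (ψ 0) (ψ 1) (ψ 2)) (betaRhoZeroFormAt ξ ε₀))
    (ψ : Fin 3 → 𝓢(ℝ³, ℂ³)) (hψ : NormalisedProfilesAt (fun j => S (ξ j)) ε₀ ψ) :
    IsComplexAverageNoDilOf (singleScaleForm (ψ 0) (ψ 1) (ψ 2))
      (betaRhoZeroFormAt (fun j => S (ξ j)) ε₀) := by
  -- the rotated-back profiles are normalised about `ξ`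
  set ψ' : Fin 3 → 𝓢(ℝ³, ℂ³) := fun j => schwartzRot S.symm (ψ j) with hψ'
  have hψ'n : NormalisedProfilesAt ξ ε₀ ψ' := by
    intro j
    have hj := (hψ j).schwartzRot S.symm
    rwa [S.symm_apply_apply] at hj
  obtain ⟨𝒟, hlam, h𝒟⟩ := h ψ' hψ'n
  refine ⟨𝒟.conjRot S, fun i θ => by rw [𝒟.conjRot_lam]; exact hlam i θ, fun U V W hU hV hW => ?_⟩
  -- `C₀[ψ](U,V,W) = C₀[ψ'](S⁻¹U, S⁻¹V, S⁻¹W)`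
  have hC : singleScaleForm (ψ 0) (ψ 1) (ψ 2) U V W =
      singleScaleForm (ψ' 0) (ψ' 1) (ψ' 2) (rot S.symm U) (rot S.symm V) (rot S.symm W) := by
    rw [hψ', singleScaleForm_schwartzRot, rot_rot_symm, rot_rot_symm, rot_rot_symm]
  rw [hC, h𝒟 _ _ _ (hU.rot S.symm) (hV.rot S.symm) (hW.rot S.symm), 𝒟.conjRot_average]
  unfold ComplexAveragingDatum.average
  refine integral_congr_ae (Eventually.of_forall fun θ => ?_)
  exact (betaRhoZeroFormAt_rot S ξ ε₀ _ _ _).symm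

end Literature.Analysis.FluidPDE.Tao2016
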